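import Literature.AlgebraicGeometry.Deformation.SmoothAffineDeformationsCocycle
import Mathlib.RingTheory.Localization.BaseChange
import Mathlib.RingTheory.Localization.Away.Basic
import HarnessLib

/-!
# Restricting a trivialisation of a smooth affine deformation to a principal localisation; the transition data of a
# trivialised cover are admissible and cocycle-exact (Hartshorne, *Deformation Theory*, proof of Thm. 10.2 (a):
# «restricting to `U_{ij}`», «on `U_{ijk}` the `φ`'s are compatible»)

Layer `Literature/AlgebraicGeometry/Deformation`, namespace `Literature.AlgebraicGeometry.Deformation.SmoothAffineDeformation`
(THEOREMS only). Sequel of ★ `SmoothAffineDeformationsTrivial` (Cor. 4.8: the trivialisation `e : A ⊗_k B₀ ≃ B'`) and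
★ `SmoothAffineDeformationsCocycle` (`transition e₁ e₂`); first file (c1) of the F3c DICTIONARY «an actual flat
deformation ↦ cocycle-exact gluing data» (cell `hodgecm-mathlib`, F-11 (A3), B-p21 (g20)).

* §1 **`exists_restrict_trivialization`** — a trivialisation `e : A ⊗_k B₀ ≃ₐ[A] B'` over the closed fibres
  (`ρ ∘ e = (a ⊗ b ↦ π(a) b)`) RESTRICTS to the principal localisations: for `g' ∈ B'` with image `g ∈ B₀`, `C' = B'_{g'}`,
  `C₀ = (B₀)_g`, there is a unique-up-to-the-characterisation `e' : A ⊗_k C₀ ≃ₐ[A] C'` with `e' (a ⊗ b/1) = e(a ⊗ b)/1`,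
  again over the closed fibres.  Key point: `e (1 ⊗ g) ≡ g'` modulo the NILPOTENT ideal `𝔫B'`, so it becomes a unit
  in `B'_{g'}` (unit + nilpotent), and `A ⊗_k (B₀)_g = (A ⊗_k B₀)_{1 ⊗ g}` (Mathlib
  `IsLocalization.tensorProduct_tensorProduct_right`).
* §2 `restrict_unique` — ring maps out of `A ⊗_k C₀` are determined on `A ⊗_k B₀`.

HC_CM is proved only modulo the 7 printed citations until rung 0 closes — nothing here bears on a summit statement.

## References
* [Hartshorne2010] R. Hartshorne, *Deformation Theory*, GTM 257, Springer (2010): Cor. 4.8 (pp. 32–33); Thm. 10.2 (a)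
  and its proof (p. 81).
* [AtiyahMacdonald1969] M. F. Atiyah, I. G. Macdonald, *Introduction to Commutative Algebra* (1969): Prop. 3.5
  (localisation commutes with tensor products), Ch. 2 pp. 30–31; Ex. 1.1 (unit + nilpotent).
-/

noncomputable section

open TensorProduct

namespace Literature.AlgebraicGeometry.Deformation.SmoothAffineDeformation

variable {k : Type*} [CommRing k]
variable {A : Type*} [CommRing A] [Algebra k A] (π : A →ₐ[k] k)
variable {B₀ : Type*} [CommRing B₀] [Algebra k B₀]
variable {B' : Type*} [CommRing B'] [Algebra k B'] [Algebra A B']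
variable {C₀ : Type*} [CommRing C₀] [Algebra k C₀] [Algebra B₀ C₀] [IsScalarTower k B₀ C₀]
variable {C' : Type*} [CommRing C'] [Algebra k C'] [Algebra A C'] [Algebra B' C'] [IsScalarTower A B' C']

/-! ## §0 Small facts -/

omit [Algebra k B'] in
/-- Elements of a nilpotent ideal are nilpotent. [cite: AtiyahMacdonald1969, Ex. 1.1 / Prop. 7.15 context] -/
theorem isNilpotent_of_mem_of_isNilpotent {I : Ideal B'} (hI : IsNilpotent I) {x : B'} (hx : x ∈ I) : IsNilpotent x := by
  obtain ⟨n, hn⟩ := hI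
  exact ⟨n, by simpa [hn] using Ideal.pow_mem_pow hx n⟩

omit [Algebra B₀ C₀] [IsScalarTower k B₀ C₀] in
/-- The closed-fibre map of the trivial deformation is natural in the `k`-algebra: `π(a) · l(b) = l(π(a) · b)`.
[cite: Hartshorne2010, Cor. 4.8, p. 32] -/
theorem specialFibreHom_map (l : B₀ →ₐ[k] C₀) (x : A ⊗[k] B₀) :
    specialFibreHom π C₀ (Algebra.TensorProduct.map (AlgHom.id k A) l x) = l (specialFibreHom π B₀ x) := by
  induction x using TensorProduct.induction_on with
  | zero => simp
  | tmul a b => simp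
  | add x y hx hy => simp [hx, hy]

/-! ## §1 Restriction of a trivialisation to a principal localisation -/

/-- **A trivialisation restricts to the principal localisations** (print: «restricting to `U_{ij}`»).  Setting:
`π : A → k` an augmentation with nilpotent kernel `𝔫`; `ρ : B' → B₀` the closed fibre of the `A`-algebra `B'`, with
kernel `𝔫B'`; `C₀ = (B₀)_g` and `C' = B'_{g'}` principal localisations with `ρ g' = g` and closed fibre
`ρ' : C' → C₀` compatible with `ρ`; `e : A ⊗_k B₀ ≃ₐ[A] B'` a trivialisation over the closed fibres.  Then there is a
trivialisation `e' : A ⊗_k C₀ ≃ₐ[A] C'` of the localisation, compatible with `e` under the localisation maps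
(`e' (a ⊗ b/1) = e(a ⊗ b)/1`) and again over the closed fibres (`ρ' ∘ e' = (a ⊗ c ↦ π(a) c)`).
[cite: Hartshorne2010, Thm. 10.2 (proof), p. 81; Cor. 4.8, pp. 32–33] [cite: AtiyahMacdonald1969, Prop. 3.5] -/
theorem exists_restrict_trivialization (h𝔫 : IsNilpotent (RingHom.ker π))
    (ρ : B' →ₐ[k] B₀) (hker : RingHom.ker ρ = (RingHom.ker π).map (algebraMap A B'))
    (g' : B') (g : B₀) (hg : ρ g' = g) [IsLocalization.Away g C₀] [IsLocalization.Away g' C']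
    (ρ' : C' →ₐ[k] C₀) (hρ' : ∀ b, ρ' (algebraMap B' C' b) = algebraMap B₀ C₀ (ρ b))
    (e : A ⊗[k] B₀ ≃ₐ[A] B') (he : ∀ x, ρ (e x) = specialFibreHom π B₀ x) :
    ∃ e' : A ⊗[k] C₀ ≃ₐ[A] C',
      (∀ (a : A) (b : B₀), e' (a ⊗ₜ algebraMap B₀ C₀ b) = algebraMap B' C' (e (a ⊗ₜ b))) ∧
      (∀ y, ρ' (e' y) = specialFibreHom π C₀ y) := by
  -- `A ⊗_k C₀` is the localisation of `A ⊗_k B₀` at the powers of `1 ⊗ g`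
  letI alg : Algebra (A ⊗[k] B₀) (A ⊗[k] C₀) :=
    (Algebra.TensorProduct.map (AlgHom.id k A) (IsScalarTower.toAlgHom k B₀ C₀)).toRingHom.toAlgebra
  have halg : ∀ x : A ⊗[k] B₀, algebraMap (A ⊗[k] B₀) (A ⊗[k] C₀) x =
      Algebra.TensorProduct.map (AlgHom.id k A) (IsScalarTower.toAlgHom k B₀ C₀) x := fun _ => rfl
  haveI : IsScalarTower A (A ⊗[k] B₀) (A ⊗[k] C₀) := IsScalarTower.of_algebraMap_eq fun a => by
    rw [halg, Algebra.TensorProduct.algebraMap_apply, Algebra.TensorProduct.algebraMap_apply,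
      Algebra.TensorProduct.map_tmul, map_one]
    rfl
  haveI hloc : IsLocalization ((Submonoid.powers g).map
      (Algebra.TensorProduct.includeRight (R := k) (A := A) (B := B₀))) (A ⊗[k] C₀) :=
    IsLocalization.tensorProduct_tensorProduct_right k A (Submonoid.powers g) C₀
      (RingHom.ext fun b => by
        change Algebra.TensorProduct.map (AlgHom.id k A) (IsScalarTower.toAlgHom k B₀ C₀) ((1 : A) ⊗ₜ b) =
          (1 : A) ⊗ₜ algebraMap B₀ C₀ b
        rw [Algebra.TensorProduct.map_tmul]
        rfl)
  -- the nilpotent discrepancies `e (1 ⊗ g) - g'` and `e⁻¹ g' - 1 ⊗ g`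
  have hρd : e ((1 : A) ⊗ₜ g) - g' ∈ RingHom.ker ρ := by
    rw [RingHom.mem_ker, map_sub, he, specialFibreHom_tmul, map_one, one_smul, hg, sub_self]
  have hd : IsNilpotent (e ((1 : A) ⊗ₜ g) - g') :=
    isNilpotent_of_mem_of_isNilpotent (hker ▸ isNilpotent_map_of_isNilpotent h𝔫) hρd
  have hd' : IsNilpotent (e.symm g' - (1 : A) ⊗ₜ g) := by
    obtain ⟨n, hn⟩ := hd
    refine ⟨n, e.injective ?_⟩
    rw [map_pow, map_sub, AlgEquiv.apply_symm_apply, map_zero, ← neg_sub, neg_pow, hn, mul_zero]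
  -- forward map: `A ⊗ B₀ → B' → C'` inverts `1 ⊗ g`
  have hu : ∀ y : (Submonoid.powers g).map (Algebra.TensorProduct.includeRight (R := k) (A := A) (B := B₀)),
      IsUnit (((algebraMap B' C').comp e.toAlgHom.toRingHom) y) := by
    rintro ⟨y, hy⟩
    rw [Submonoid.map_powers] at hy
    obtain ⟨n, rfl⟩ := (Submonoid.mem_powers_iff _ _).mp hy
    change IsUnit (algebraMap B' C' (e ((Algebra.TensorProduct.includeRight (R := k) (A := A) (B := B₀) g) ^ n)))
    rw [map_pow, map_pow]
    refine IsUnit.pow n ?_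
    have h1 : algebraMap B' C' (e (Algebra.TensorProduct.includeRight (R := k) (A := A) (B := B₀) g)) =
        algebraMap B' C' g' + algebraMap B' C' (e ((1 : A) ⊗ₜ g) - g') := by
      rw [← map_add, add_sub_cancel]
      rfl
    rw [h1]
    exact (hd.map (algebraMap B' C')).isUnit_add_left_of_commute (IsLocalization.Away.algebraMap_isUnit g')
      (Commute.all _ _)
  let f : A ⊗[k] C₀ →+* C' := IsLocalization.lift (M := (Submonoid.powers g).map
    (Algebra.TensorProduct.includeRight (R := k) (A := A) (B := B₀))) hu
  have hf : ∀ x : A ⊗[k] B₀, f (algebraMap (A ⊗[k] B₀) (A ⊗[k] C₀) x) = algebraMap B' C' (e x) :=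
    fun x => IsLocalization.lift_eq hu x
  -- backward map: `B' → A ⊗ B₀ → A ⊗ C₀` inverts `g'`
  have hu' : IsUnit (((algebraMap (A ⊗[k] B₀) (A ⊗[k] C₀)).comp e.symm.toAlgHom.toRingHom) g') := by
    change IsUnit (algebraMap (A ⊗[k] B₀) (A ⊗[k] C₀) (e.symm g'))
    have h1 : algebraMap (A ⊗[k] B₀) (A ⊗[k] C₀) (e.symm g') = algebraMap (A ⊗[k] B₀) (A ⊗[k] C₀)
        (Algebra.TensorProduct.includeRight (R := k) (A := A) (B := B₀) g) +
        algebraMap (A ⊗[k] B₀) (A ⊗[k] C₀) (e.symm g' - (1 : A) ⊗ₜ g) := by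
      rw [← map_add, Algebra.TensorProduct.includeRight_apply, add_sub_cancel]
    rw [h1]
    refine (hd'.map _).isUnit_add_left_of_commute ?_ (Commute.all _ _)
    exact IsLocalization.map_units (A ⊗[k] C₀) ⟨Algebra.TensorProduct.includeRight (R := k) (A := A) (B := B₀) g,
      Submonoid.mem_map_of_mem _ (Submonoid.mem_powers g)⟩
  let f' : C' →+* A ⊗[k] C₀ := IsLocalization.Away.lift g' hu'
  have hf' : ∀ b : B', f' (algebraMap B' C' b) = algebraMap (A ⊗[k] B₀) (A ⊗[k] C₀) (e.symm b) :=
    fun b => IsLocalization.Away.lift_eq g' hu' b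
  -- two-sided inverse
  have h1 : f'.comp f = RingHom.id _ := by
    refine IsLocalization.ringHom_ext ((Submonoid.powers g).map
      (Algebra.TensorProduct.includeRight (R := k) (A := A) (B := B₀))) (RingHom.ext fun x => ?_)
    change f' (f (algebraMap (A ⊗[k] B₀) (A ⊗[k] C₀) x)) = algebraMap (A ⊗[k] B₀) (A ⊗[k] C₀) x
    rw [hf, hf', AlgEquiv.symm_apply_apply]
  have h2 : f.comp f' = RingHom.id _ := by
    refine IsLocalization.ringHom_ext (Submonoid.powers g') (RingHom.ext fun b => ?_)
    change f (f' (algebraMap B' C' b)) = algebraMap B' C' b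
    rw [hf', hf, AlgEquiv.apply_symm_apply]
  let E : A ⊗[k] C₀ ≃+* C' := RingEquiv.ofRingHom f f' h2 h1
  have hE : ∀ a : A, E (algebraMap A (A ⊗[k] C₀) a) = algebraMap A C' a := fun a => by
    change f (algebraMap A (A ⊗[k] C₀) a) = algebraMap A C' a
    rw [IsScalarTower.algebraMap_apply A (A ⊗[k] B₀) (A ⊗[k] C₀), hf, AlgEquiv.commutes,
      ← IsScalarTower.algebraMap_apply]
  refine ⟨AlgEquiv.ofRingEquiv (f := E) hE, fun a b => ?_, fun y => ?_⟩
  · change f (a ⊗ₜ algebraMap B₀ C₀ b) = algebraMap B' C' (e (a ⊗ₜ b))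
    rw [← hf, halg, Algebra.TensorProduct.map_tmul]
    rfl
  · -- closed fibres: both sides are ring maps out of the localisation `A ⊗ C₀` agreeing on `A ⊗ B₀`
    change (ρ'.toRingHom.comp f) y = (specialFibreHom π C₀).toRingHom y
    congr 1
    refine IsLocalization.ringHom_ext ((Submonoid.powers g).map
      (Algebra.TensorProduct.includeRight (R := k) (A := A) (B := B₀))) (RingHom.ext fun x => ?_)
    change ρ' (f (algebraMap (A ⊗[k] B₀) (A ⊗[k] C₀) x)) = specialFibreHom π C₀ (algebraMap (A ⊗[k] B₀) (A ⊗[k] C₀) x)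
    rw [hf, hρ', he, halg, specialFibreHom_map]
    rfl

/-! ## §2 Ring maps out of `A ⊗_k C₀` are determined on `A ⊗_k B₀`; restrictions compose -/

omit [Algebra k B'] [Algebra A B'] [Algebra k C'] [Algebra A C'] [Algebra B' C'] [IsScalarTower A B' C'] in
/-- `A ⊗_k (B₀)_g = (A ⊗_k B₀)_{1 ⊗ g}`: the base change of a principal localisation is the principal localisation of
the base change (Mathlib `IsLocalization.tensorProduct_tensorProduct_right`), for the algebra structure `a ⊗ b ↦ a ⊗ b/1`.
[cite: AtiyahMacdonald1969, Prop. 3.5] -/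
theorem isLocalization_baseChange (A : Type*) [CommRing A] [Algebra k A] (g : B₀) [IsLocalization.Away g C₀] :
    letI := (Algebra.TensorProduct.map (AlgHom.id k A) (IsScalarTower.toAlgHom k B₀ C₀)).toRingHom.toAlgebra
    IsLocalization ((Submonoid.powers g).map (Algebra.TensorProduct.includeRight (R := k) (A := A) (B := B₀)))
      (A ⊗[k] C₀) := by
  letI alg : Algebra (A ⊗[k] B₀) (A ⊗[k] C₀) :=
    (Algebra.TensorProduct.map (AlgHom.id k A) (IsScalarTower.toAlgHom k B₀ C₀)).toRingHom.toAlgebra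
  haveI : IsScalarTower A (A ⊗[k] B₀) (A ⊗[k] C₀) := IsScalarTower.of_algebraMap_eq fun a => by
    change algebraMap A (A ⊗[k] C₀) a =
      Algebra.TensorProduct.map (AlgHom.id k A) (IsScalarTower.toAlgHom k B₀ C₀) (algebraMap A (A ⊗[k] B₀) a)
    rw [Algebra.TensorProduct.algebraMap_apply, Algebra.TensorProduct.algebraMap_apply, Algebra.TensorProduct.map_tmul,
      map_one]
    rfl
  exact IsLocalization.tensorProduct_tensorProduct_right k A (Submonoid.powers g) C₀
    (RingHom.ext fun b => by
      change Algebra.TensorProduct.map (AlgHom.id k A) (IsScalarTower.toAlgHom k B₀ C₀) ((1 : A) ⊗ₜ b) =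
        (1 : A) ⊗ₜ algebraMap B₀ C₀ b
      rw [Algebra.TensorProduct.map_tmul]
      rfl)

omit [Algebra k B'] [Algebra A B'] [Algebra k C'] [Algebra A C'] [Algebra B' C'] [IsScalarTower A B' C'] in
/-- **Ring maps out of `A ⊗_k (B₀)_g` are determined by their values on `a ⊗ b/1`.**
[cite: AtiyahMacdonald1969, Prop. 3.5] [cite: Hartshorne2010, Thm. 10.2 (proof), p. 81] -/
theorem ringHom_ext_baseChange_away (A : Type*) [CommRing A] [Algebra k A] (g : B₀) [IsLocalization.Away g C₀]
    {P : Type*} [Semiring P] {φ ψ : A ⊗[k] C₀ →+* P}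
    (h : ∀ (a : A) (b : B₀), φ (a ⊗ₜ algebraMap B₀ C₀ b) = ψ (a ⊗ₜ algebraMap B₀ C₀ b)) : φ = ψ := by
  letI alg : Algebra (A ⊗[k] B₀) (A ⊗[k] C₀) :=
    (Algebra.TensorProduct.map (AlgHom.id k A) (IsScalarTower.toAlgHom k B₀ C₀)).toRingHom.toAlgebra
  haveI := isLocalization_baseChange (k := k) (B₀ := B₀) (C₀ := C₀) A g
  refine IsLocalization.ringHom_ext ((Submonoid.powers g).map
    (Algebra.TensorProduct.includeRight (R := k) (A := A) (B := B₀))) (RingHom.ext fun x => ?_)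
  change φ (Algebra.TensorProduct.map (AlgHom.id k A) (IsScalarTower.toAlgHom k B₀ C₀) x) =
    ψ (Algebra.TensorProduct.map (AlgHom.id k A) (IsScalarTower.toAlgHom k B₀ C₀) x)
  induction x using TensorProduct.induction_on with
  | zero => simp
  | tmul a b => exact h a b
  | add x y hx hy => rw [map_add, map_add, map_add, hx, hy]

omit [Algebra k B'] [Algebra k C'] [IsScalarTower A B' C'] in
/-- **Restrictions compose**: if `ε` (over `C' = B'_{g'}`) and `δ` (over a further localisation `D'`) are both
restrictions of the same trivialisation `e` of `B'`, then `δ` restricts `ε`. [cite: Hartshorne2010, Thm. 10.2 (proof), p. 81] -/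
theorem restrict_compat (g : B₀) [IsLocalization.Away g C₀]
    {D₀ : Type*} [CommRing D₀] [Algebra k D₀] [Algebra B₀ D₀] [IsScalarTower k B₀ D₀] [Algebra C₀ D₀]
    [IsScalarTower B₀ C₀ D₀] [IsScalarTower k C₀ D₀]
    {D' : Type*} [CommRing D'] [Algebra A D'] [Algebra B' D'] [IsScalarTower A B' D'] [Algebra C' D']
    [IsScalarTower B' C' D'] [IsScalarTower A C' D']
    (e : A ⊗[k] B₀ ≃ₐ[A] B') (ε : A ⊗[k] C₀ ≃ₐ[A] C')
    (hε : ∀ (a : A) (b : B₀), ε (a ⊗ₜ algebraMap B₀ C₀ b) = algebraMap B' C' (e (a ⊗ₜ b)))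
    (δ : A ⊗[k] D₀ ≃ₐ[A] D') (hδ : ∀ (a : A) (b : B₀), δ (a ⊗ₜ algebraMap B₀ D₀ b) = algebraMap B' D' (e (a ⊗ₜ b)))
    (a : A) (c : C₀) : δ (a ⊗ₜ algebraMap C₀ D₀ c) = algebraMap C' D' (ε (a ⊗ₜ c)) := by
  have key : (δ.toAlgHom.toRingHom.comp
      (Algebra.TensorProduct.map (AlgHom.id k A) (IsScalarTower.toAlgHom k C₀ D₀)).toRingHom) =
      (algebraMap C' D').comp ε.toAlgHom.toRingHom := by
    refine ringHom_ext_baseChange_away (k := k) (B₀ := B₀) (C₀ := C₀) A g fun a b => ?_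
    change δ (Algebra.TensorProduct.map (AlgHom.id k A) (IsScalarTower.toAlgHom k C₀ D₀) (a ⊗ₜ algebraMap B₀ C₀ b)) =
      algebraMap C' D' (ε (a ⊗ₜ algebraMap B₀ C₀ b))
    rw [Algebra.TensorProduct.map_tmul, hε, ← IsScalarTower.algebraMap_apply B' C' D']
    change δ (a ⊗ₜ algebraMap C₀ D₀ (algebraMap B₀ C₀ b)) = _
    rw [← IsScalarTower.algebraMap_apply B₀ C₀ D₀, hδ]
  have h := RingHom.congr_fun key (a ⊗ₜ c)
  change δ (Algebra.TensorProduct.map (AlgHom.id k A) (IsScalarTower.toAlgHom k C₀ D₀) (a ⊗ₜ c)) =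
    algebraMap C' D' (ε (a ⊗ₜ c)) at h
  rw [Algebra.TensorProduct.map_tmul] at h
  exact h

/-! ## §3 The restricted transition is the transition of the restrictions; the cocycle clause -/

omit [Algebra k C'] in
/-- **The restriction `ρ` of the transition `ψ = transition ε₁ ε₂` of two trivialisations of an overlap ring `C'` to a
further localisation `D'` IS the transition of the restricted trivialisations** — hence unique (F3a's `ρ` in the
`∀`-form of the cocycle clause). [cite: Hartshorne2010, Thm. 10.2 (proof), p. 81: «on `U_{ijk}`»] -/
theorem eq_transition_of_restrict (g : B₀) [IsLocalization.Away g C₀]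
    {D' : Type*} [CommRing D'] [Algebra A D'] [Algebra C' D'] [IsScalarTower A C' D']
    -- here `B₀ ⊆ C₀` play the roles «double overlap ⊆ triple overlap» and `C', D'` their deformations
    (ε₁ ε₂ : A ⊗[k] B₀ ≃ₐ[A] C') (δ₁ δ₂ : A ⊗[k] C₀ ≃ₐ[A] D')
    (h₁ : ∀ (a : A) (b : B₀), δ₁ (a ⊗ₜ algebraMap B₀ C₀ b) = algebraMap C' D' (ε₁ (a ⊗ₜ b)))
    (h₂ : ∀ (a : A) (b : B₀), δ₂ (a ⊗ₜ algebraMap B₀ C₀ b) = algebraMap C' D' (ε₂ (a ⊗ₜ b)))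
    {Φ : A ⊗[k] B₀ →ₐ[A] A ⊗[k] C₀} (hΦ : ∀ a b, Φ (a ⊗ₜ b) = a ⊗ₜ algebraMap B₀ C₀ b)
    (ρ : A ⊗[k] C₀ ≃ₐ[A] A ⊗[k] C₀) (hρ : ∀ x, ρ (Φ x) = Φ (transition ε₁ ε₂ x)) :
    ρ = transition δ₁ δ₂ := by
  have hΦ' : ∀ x, Φ x = Algebra.TensorProduct.map (AlgHom.id k A) (IsScalarTower.toAlgHom k B₀ C₀) x := by
    intro x
    induction x using TensorProduct.induction_on with
    | zero => simp
    | tmul a b => rw [hΦ, Algebra.TensorProduct.map_tmul]; rfl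
    | add x y hx hy => rw [map_add, map_add, hx, hy]
  -- compatibility of `δ₂` with `ε₂` on all of `A ⊗ B₀`
  have h₂' : ∀ x, δ₂ (Φ x) = algebraMap C' D' (ε₂ x) := by
    intro x
    induction x using TensorProduct.induction_on with
    | zero => simp
    | tmul a b => rw [hΦ, h₂]
    | add x y hx hy => rw [map_add, map_add, hx, hy, map_add, map_add]
  have h₁' : ∀ x, δ₁ (Φ x) = algebraMap C' D' (ε₁ x) := by
    intro x
    induction x using TensorProduct.induction_on with
    | zero => simp
    | tmul a b => rw [hΦ, h₁]
    | add x y hx hy => rw [map_add, map_add, hx, hy, map_add, map_add]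
  apply AlgEquiv.ext
  intro y
  have key : ρ.toAlgHom.toRingHom = (transition δ₁ δ₂).toAlgHom.toRingHom := by
    refine ringHom_ext_baseChange_away (k := k) (B₀ := B₀) (C₀ := C₀) A g fun a b => ?_
    change ρ (a ⊗ₜ algebraMap B₀ C₀ b) = transition δ₁ δ₂ (a ⊗ₜ algebraMap B₀ C₀ b)
    rw [← hΦ, hρ, transition_apply, transition_apply]
    apply δ₂.injective
    rw [AlgEquiv.apply_symm_apply, h₁', h₂', AlgEquiv.apply_symm_apply]
  exact RingHom.congr_fun key y

/-- **THE COCYCLE CLAUSE for the transition data of a trivialised cover** (F3a's `∀`-form at `(j, l, m)`): over the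
triple-overlap deformation `D'` with closed fibre `D₀`, a localisation of each double-overlap closed fibre `C₁ = C_{jl}`,
`C₂ = C_{lm}`, `C₃ = C_{jm}`, let `δⱼ, δₗ, δₘ : A ⊗_k D₀ ≃ D'` restrict the chart trivialisations and `εᵢ` the double-
overlap restrictions; then any automorphisms `ρ₁, ρ₂, ρ₃` of `A ⊗_k D₀` restricting `ψ_{jl} = transition εⱼ εₗ`,
`ψ_{lm}`, `ψ_{jm}` satisfy `ρ₂ * ρ₁ = ρ₃` (they ARE `transition δⱼ δₗ` etc., and ★ `transition_trans`).
[cite: Hartshorne2010, Thm. 10.2 (proof), p. 81] -/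
theorem cocycle_clause_of_restrict
    {C₁ C₂ C₃ D₀ : Type*} [CommRing C₁] [Algebra k C₁] [CommRing C₂] [Algebra k C₂] [CommRing C₃] [Algebra k C₃]
    [CommRing D₀] [Algebra k D₀] [Algebra C₁ D₀] [IsScalarTower k C₁ D₀] [Algebra C₂ D₀] [IsScalarTower k C₂ D₀]
    [Algebra C₃ D₀] [IsScalarTower k C₃ D₀]
    (g₁ : C₁) [IsLocalization.Away g₁ D₀] (g₂ : C₂) [IsLocalization.Away g₂ D₀] (g₃ : C₃) [IsLocalization.Away g₃ D₀]
    {C'₁ C'₂ C'₃ D' : Type*} [CommRing C'₁] [Algebra A C'₁] [CommRing C'₂] [Algebra A C'₂] [CommRing C'₃] [Algebra A C'₃]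
    [CommRing D'] [Algebra A D'] [Algebra C'₁ D'] [IsScalarTower A C'₁ D'] [Algebra C'₂ D'] [IsScalarTower A C'₂ D']
    [Algebra C'₃ D'] [IsScalarTower A C'₃ D']
    (εⱼ₁ εₗ₁ : A ⊗[k] C₁ ≃ₐ[A] C'₁) (εₗ₂ εₘ₂ : A ⊗[k] C₂ ≃ₐ[A] C'₂) (εⱼ₃ εₘ₃ : A ⊗[k] C₃ ≃ₐ[A] C'₃)
    (δⱼ δₗ δₘ : A ⊗[k] D₀ ≃ₐ[A] D')
    (hⱼ₁ : ∀ (a : A) (c : C₁), δⱼ (a ⊗ₜ algebraMap C₁ D₀ c) = algebraMap C'₁ D' (εⱼ₁ (a ⊗ₜ c)))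
    (hₗ₁ : ∀ (a : A) (c : C₁), δₗ (a ⊗ₜ algebraMap C₁ D₀ c) = algebraMap C'₁ D' (εₗ₁ (a ⊗ₜ c)))
    (hₗ₂ : ∀ (a : A) (c : C₂), δₗ (a ⊗ₜ algebraMap C₂ D₀ c) = algebraMap C'₂ D' (εₗ₂ (a ⊗ₜ c)))
    (hₘ₂ : ∀ (a : A) (c : C₂), δₘ (a ⊗ₜ algebraMap C₂ D₀ c) = algebraMap C'₂ D' (εₘ₂ (a ⊗ₜ c)))
    (hⱼ₃ : ∀ (a : A) (c : C₃), δⱼ (a ⊗ₜ algebraMap C₃ D₀ c) = algebraMap C'₃ D' (εⱼ₃ (a ⊗ₜ c)))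
    (hₘ₃ : ∀ (a : A) (c : C₃), δₘ (a ⊗ₜ algebraMap C₃ D₀ c) = algebraMap C'₃ D' (εₘ₃ (a ⊗ₜ c)))
    {Φ₁ : A ⊗[k] C₁ →ₐ[A] A ⊗[k] D₀} (hΦ₁ : ∀ a c, Φ₁ (a ⊗ₜ c) = a ⊗ₜ algebraMap C₁ D₀ c)
    {Φ₂ : A ⊗[k] C₂ →ₐ[A] A ⊗[k] D₀} (hΦ₂ : ∀ a c, Φ₂ (a ⊗ₜ c) = a ⊗ₜ algebraMap C₂ D₀ c)
    {Φ₃ : A ⊗[k] C₃ →ₐ[A] A ⊗[k] D₀} (hΦ₃ : ∀ a c, Φ₃ (a ⊗ₜ c) = a ⊗ₜ algebraMap C₃ D₀ c)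
    (ρ₁ ρ₂ ρ₃ : A ⊗[k] D₀ ≃ₐ[A] A ⊗[k] D₀)
    (hρ₁ : ∀ x, ρ₁ (Φ₁ x) = Φ₁ (transition εⱼ₁ εₗ₁ x)) (hρ₂ : ∀ x, ρ₂ (Φ₂ x) = Φ₂ (transition εₗ₂ εₘ₂ x))
    (hρ₃ : ∀ x, ρ₃ (Φ₃ x) = Φ₃ (transition εⱼ₃ εₘ₃ x)) : ρ₂ * ρ₁ = ρ₃ := by
  rw [eq_transition_of_restrict (k := k) g₁ εⱼ₁ εₗ₁ δⱼ δₗ hⱼ₁ hₗ₁ hΦ₁ ρ₁ hρ₁,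
    eq_transition_of_restrict (k := k) g₂ εₗ₂ εₘ₂ δₗ δₘ hₗ₂ hₘ₂ hΦ₂ ρ₂ hρ₂,
    eq_transition_of_restrict (k := k) g₃ εⱼ₃ εₘ₃ δⱼ δₘ hⱼ₃ hₘ₃ hΦ₃ ρ₃ hρ₃]
  exact (transition_trans δⱼ δₗ δₘ).symm


end Literature.AlgebraicGeometry.Deformation.SmoothAffineDeformation

end
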